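import Literature.AlgebraicGeometry.HodgeTheory.RealSl2BlocksTimesCMProductSpan
import Literature.AlgebraicGeometry.HodgeTheory.Sl2IsotypicTimesCMDivisorClasses
import Literature.AlgebraicGeometry.Pohlmann1968.SimpleCMAbelianVarietyPowersDivisorGenerated
import HarnessLib

/-!
# `B = D` on `B × Z` for `B` with slots over an abelian variety with real `𝔰𝔩₂`-block data and `Z` with slots over `C` of CM type:
# Moonen–Zarhin 1999 Thm. (3.2)(2) PROVED for the «RM × CM» class; `A × E`, `A × T` (`E` a CM elliptic curve, `T` a simple CM threefold) are stably nondegenerate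

Family `hodge`, layer `Literature/AlgebraicGeometry/HodgeTheory`.  Written for the cell `pub-hodgecm2` (COR-CM), seat `b27` gen 35,
count-neutral lane MT-RANK-FIVE-DIVISORS (file F6; companion of `Sl2IsotypicTimesCMDivisorClasses`, the `𝔰𝔩₂`-ISOTYPIC class, with
the same §1 lemma `isDivisorGenerated_prod_of_productSpan`).  UNCONDITIONAL; theorems only, no definition, no named fact; nothing
here uses or asserts HC_CM.

PUBLISHED STATEMENT.  Moonen–Zarhin, Math. Ann. 315 (1999), §3 Thm. (3.2) (after Hazama): «Let `X₁` and `X₂` be complex abelian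
varieties which both satisfy condition (D). … (2) Suppose `X₁` has no factors of Type 4 and `X₂` is of CM-type.  Then `X₁ × X₂`
again satisfies (D) and `Hg(X₁ × X₂) = Hg(X₁) × Hg(X₂)`.»  The tree has the REAL-MULTIPLICATION class `HasRealSl2Blocks A`
(`End⁰(A)` commutative with real characters cutting `H¹(A) ⊗ ℂ` into two-dimensional blocks carrying `(1,0)`/`(0,1)` bases —
`End⁰(A)` a totally real field of degree `dim A` (Ribet 1983), `End⁰(A) = ℚ` for an elliptic curve, finite orthogonal products
of such): condition (D) for `A` (`HasRealSl2Blocks.isStablyNondegenerate`), case (1) of Thm. (3.2) (`HasRealSl2Blocks.prod`,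
`RealSl2BlocksProducts`), and the product span for `A × C`, `C` of CM type (`HasRealSl2Blocks.hodgeClassesProductSpan_of_avSlots`,
`RealSl2BlocksTimesCMProductSpan`) — but the divisor consequence (case (2) of Thm. (3.2)) only as HC statements modulo HC of the
CM factor.  This file records case (2) as condition (D):

* **`HasRealSl2Blocks.isDivisorGenerated_prod_of_avSlots`** — `B` with `n` slots over `A` (real `𝔰𝔩₂`-block data), `Z` with
  `n` slots over `C` of CM type, `B(Z) = D(Z)` ⟹ `B(B × Z) = D(B × Z)`;
* **`HasRealSl2Blocks.isStablyNondegenerate_prod_of_isOfCMType`** — `C` of CM type and stably nondegenerate ⟹ `A × C` stably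
  nondegenerate (all mixed powers `A^{M+1} × C^{N+1}`: `…_powSucc_prod_powSucc_…`);
* UNCONDITIONAL instances: **`HasRealSl2Blocks.isStablyNondegenerate_prod_cmCurve`** (`C = E` a CM elliptic curve, Tate–Murasaki),
  **`HasRealSl2Blocks.isStablyNondegenerate_prod_of_isSimple_of_isOfCMType_of_dim_le_three`** (`C` a SIMPLE CM abelian variety of
  dimension `≤ 3`, Pohlmann / Moonen–Zarhin (5.2): `isDivisorGenerated_powSucc_of_isSimple_of_isOfCMType_of_dim_le_three`), and the
  Hodge conjecture for all powers of these products; real-multiplication readings `…_of_isTotallyReal_…`.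

## References
* [MoonenZarhin1999LowDim] B. Moonen, Yu. Zarhin, Math. Ann. 315 (1999) 711–733, §2 condition (D), §3 Thm. (3.2), (3.8), §5 (5.2)
  [corpus: paper:arxiv-math_9901113 p. 4–6]. [cite: MoonenZarhin1999LowDim, §3 Thm. (3.2)(2)]
* [Hazama1989] F. Hazama, Duke Math. J. 58 (1989) 31–37 (= Gordon 7.6.2). [cite: Hazama1989, Thm. (= Gordon 7.6.2)]
* [Hazama1983] F. Hazama, Tôhoku Math. J. 35 (1983), Thm. (1.1), §3. [cite: Hazama1983, §3 (pp. 305–306)]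
* [Ribet1983] K. A. Ribet, Amer. J. Math. 105 (1983), Thm. 0–1. [cite: Ribet1983, Thm. 0–1]
* [Gordon1999HodgeAVSurvey] B. B. Gordon, App. B of Lewis (1999), Thm. 7.5, Def. 7.6, Thm. 7.6.2. [cite: Gordon1999HodgeAVSurvey, Thm. 7.5 and Thm. 7.6.2]
* [vanGeemen1994HodgeAV] B. van Geemen, LNM 1594 (1994), §2.4–2.5, Thm. 4.3. [cite: vanGeemen1994HodgeAV, §2.4–2.5 and Thm. 4.3]
* [Lombardo2016] D. Lombardo, Ann. Inst. Fourier 66 (2016), Lemma 3.4 (p. 1229). [cite: Lombardo2016, Lemma 3.4 (p. 1229)]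
-/

noncomputable section

open CategoryTheory Module NumberField

namespace Literature.AlgebraicGeometry.HodgeTheory

open Literature.AlgebraicGeometry.Motives (AbelianVariety)
open Literature.AlgebraicGeometry.ComplexMultiplication (EndField)
open Literature.AlgebraicGeometry.Pohlmann1968 (isDivisorGenerated_powSucc_of_isSimple_of_isOfCMType_of_dim_le_three)

/-! ### §1 Moonen–Zarhin Thm. (3.2)(2) for real `𝔰𝔩₂`-block data -/

section Slots

variable {A B C Z : AbelianVariety ℂ} {n : ℕ} {gB : Fin n → (B ⟶ A)} {gC : Fin n → (Z ⟶ C)}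

/-- **Moonen–Zarhin 1999 Thm. (3.2)(2), PROVED for the «RM × CM» class.**  Let `A` carry real `𝔰𝔩₂`-block data
(`HasRealSl2Blocks A`: no factor of Type 4), `B` have `n` slots over `A`, `C` be of CM type and `Z` have `n` slots over `C` with
`B(Z) = D(Z)`.  Then `B(B × Z) = D(B × Z)`: the product span (`HasRealSl2Blocks.hodgeClassesProductSpan_of_avSlots`, Lombardo 3.4
/ Moonen–Zarhin (3.1) proved for this class), `B(B) = D(B)` (`HasRealSl2Blocks.isDivisorGenerated_of_avSlots`, Ribet/Hazama) and
`isDivisorGenerated_prod_of_productSpan`. [cite: MoonenZarhin1999LowDim, §3 Thm. (3.2)(2)] [cite: Hazama1989, Thm. (= Gordon 7.6.2)]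
[cite: Lombardo2016, Lemma 3.4 (p. 1229)] -/
theorem HasRealSl2Blocks.isDivisorGenerated_prod_of_avSlots (hA : HasRealSl2Blocks A) (hC : Milne1999.IsOfCMType C)
    (hgB : AVSlots A B gB) (hgC : AVSlots C Z gC) (hZD : IsDivisorGenerated Z) : IsDivisorGenerated (B.prod Z) :=
  isDivisorGenerated_prod_of_productSpan B Z (hA.hodgeClassesProductSpan_of_avSlots hC hgB hgC)
    (hA.isDivisorGenerated_of_avSlots hgB) hZD

/-- **The binder shape of Thm. (3.2)(2) / Hazama, discharged on this class**: `HasNoTypeIVFactor B → IsOfCMType Z →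
IsDivisorGenerated B → IsDivisorGenerated Z → IsDivisorGenerated (B × Z)` (the first three hypotheses are theorems here).
[cite: MoonenZarhin1999LowDim, §3 Thm. (3.2)(2)] [cite: Hazama1989, Thm. (= Gordon 7.6.2)] -/
theorem HasRealSl2Blocks.moonenZarhin_3_2_2_of_avSlots (hA : HasRealSl2Blocks A) (hC : Milne1999.IsOfCMType C)
    (hgB : AVSlots A B gB) (hgC : AVSlots C Z gC) :
    HasNoTypeIVFactor B → Milne1999.IsOfCMType Z → IsDivisorGenerated B → IsDivisorGenerated Z →
      IsDivisorGenerated (B.prod Z) :=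
  fun _ _ _ hZD => hA.isDivisorGenerated_prod_of_avSlots hC hgB hgC hZD

end Slots

/-! ### §2 `A × C` is stably nondegenerate when the CM factor is -/

section Powers

variable {A C : AbelianVariety ℂ}

/-- **`B(A^{N+1} × C^{N+1}) = D`** from `B(C^{N+1}) = D`, for `A` with real `𝔰𝔩₂`-block data and `C` of CM type.
[cite: MoonenZarhin1999LowDim, §3 Thm. (3.2)(2)] [cite: Gordon1999HodgeAVSurvey, Thm. 7.5 and Thm. 7.6.2] -/
theorem HasRealSl2Blocks.isDivisorGenerated_powSucc_prod_powSucc_of_isOfCMType (hA : HasRealSl2Blocks A)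
    (hC : Milne1999.IsOfCMType C) (N : ℕ) (hD : IsDivisorGenerated (C.powSucc N)) :
    IsDivisorGenerated ((A.powSucc N).prod (C.powSucc N)) :=
  hA.isDivisorGenerated_prod_of_avSlots hC (AVSlots.powSucc A N) (AVSlots.powSucc C N) hD

/-- **Moonen–Zarhin Thm. (3.2)(2) as condition (D): `A × C` is stably nondegenerate** for `A` with real `𝔰𝔩₂`-block data and
`C` of CM type satisfying condition (D) (`IsStablyNondegenerate C`): `(A × C)^{N+1} ≼ A^{N+1} × C^{N+1}` has `B = D` for every `N`.
[cite: MoonenZarhin1999LowDim, §3 Thm. (3.2)(2)] [cite: Gordon1999HodgeAVSurvey, Thm. 7.5 (1), Def. 7.6 and Thm. 7.6.2] -/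
theorem HasRealSl2Blocks.isStablyNondegenerate_prod_of_isOfCMType (hA : HasRealSl2Blocks A) (hC : Milne1999.IsOfCMType C)
    (hCs : IsStablyNondegenerate C) : IsStablyNondegenerate (A.prod C) := fun N =>
  isDivisorGenerated_powSucc_prod_of_isDivisorGenerated_prod_powSucc A C N
    (hA.isDivisorGenerated_powSucc_prod_powSucc_of_isOfCMType hC N (hCs N))

/-- **All mixed powers `A^{M+1} × C^{N+1}` are stably nondegenerate** under the same hypotheses.
[cite: MoonenZarhin1999LowDim, §3 Thm. (3.2)(2)] [cite: Gordon1999HodgeAVSurvey, Def. 7.6 and Thm. 7.6.2] -/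
theorem HasRealSl2Blocks.isStablyNondegenerate_powSucc_prod_powSucc_of_isOfCMType (hA : HasRealSl2Blocks A)
    (hC : Milne1999.IsOfCMType C) (hCs : IsStablyNondegenerate C) (M N : ℕ) :
    IsStablyNondegenerate ((A.powSucc M).prod (C.powSucc N)) :=
  (hA.isStablyNondegenerate_prod_of_isOfCMType hC hCs).powSucc_prod_powSucc M N

/-- **UNCONDITIONAL: `A × E` is stably nondegenerate** for `A` with real `𝔰𝔩₂`-block data and `E` an elliptic curve with complex
multiplication (Tate–Murasaki `B(E^{N+1}) = D`, `EllipticCurve.isStablyNondegenerate`) — Moonen–Zarhin (3.8)–(3.9) for the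
real-multiplication class and all powers. [cite: MoonenZarhin1999LowDim, §3 Thm. (3.2)(2) and (3.8)–(3.9)]
[cite: vanGeemen1994HodgeAV, Thm. 4.3] [cite: Gordon1999HodgeAVSurvey, Thm. 7.5 (1) and Def. 7.6] -/
theorem HasRealSl2Blocks.isStablyNondegenerate_prod_cmCurve (hA : HasRealSl2Blocks A) {E : AbelianVariety ℂ} (hE : E.dim = 1)
    (hEcm : Milne1999.IsOfCMType E) : IsStablyNondegenerate (A.prod E) :=
  hA.isStablyNondegenerate_prod_of_isOfCMType hEcm (EllipticCurve.isStablyNondegenerate hE)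

/-- **UNCONDITIONAL: `A × T` is stably nondegenerate** for `A` with real `𝔰𝔩₂`-block data and `T` a SIMPLE abelian variety of CM
type of dimension `≤ 3` (CM elliptic curves, simple CM surfaces, simple CM threefolds: every power has `B = D`, Pohlmann 1968 /
Moonen–Zarhin (5.2), the tree's `isDivisorGenerated_powSucc_of_isSimple_of_isOfCMType_of_dim_le_three`).
[cite: MoonenZarhin1999LowDim, §3 Thm. (3.2)(2) and §5 (5.2)] [cite: Gordon1999HodgeAVSurvey, Thm. 7.5 (1) and Thm. 7.6.2] -/
theorem HasRealSl2Blocks.isStablyNondegenerate_prod_of_isSimple_of_isOfCMType_of_dim_le_three (hA : HasRealSl2Blocks A)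
    {T : AbelianVariety ℂ} (hs : T.IsSimple) (h0 : 0 < T.dim) (h3 : T.dim ≤ 3) (hcm : Milne1999.IsOfCMType T) :
    IsStablyNondegenerate (A.prod T) :=
  hA.isStablyNondegenerate_prod_of_isOfCMType hcm fun N =>
    isDivisorGenerated_powSucc_of_isSimple_of_isOfCMType_of_dim_le_three T hs h0 h3 hcm N

/-- **The Hodge conjecture for every power `(A × T)^{N+1}`**, `A` with real `𝔰𝔩₂`-block data, `T` simple of CM type of dimension
`≤ 3`, UNCONDITIONALLY (no HC_CM hypothesis: compare `HasRealSl2Blocks.hodgeConjectureFor_prod_of_cmHodgeHypothesis`).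
[cite: MoonenZarhin1999LowDim, §2 condition (D), §3 Thm. (3.2)(2) and §5 (5.2)] [cite: vanGeemen1994HodgeAV, §2.4] -/
theorem HasRealSl2Blocks.hodgeConjectureFor_powSucc_prod_of_isSimple_of_isOfCMType_of_dim_le_three (hA : HasRealSl2Blocks A)
    {T : AbelianVariety ℂ} (hs : T.IsSimple) (h0 : 0 < T.dim) (h3 : T.dim ≤ 3) (hcm : Milne1999.IsOfCMType T) (N : ℕ) :
    HodgeConjectureFor ((A.prod T).powSucc N).dim ((A.prod T).powSucc N).X :=
  (hA.isStablyNondegenerate_prod_of_isSimple_of_isOfCMType_of_dim_le_three hs h0 h3 hcm).hodgeConjectureFor_powSucc N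

end Powers

/-! ### §3 Real-multiplication readings -/

section RealMultiplication

variable {A C : AbelianVariety ℂ}

/-- **Ribet-type real multiplication times a stably nondegenerate CM variety is stably nondegenerate**: `End⁰(A)` a totally real
field of degree `dim A` (`hasRealSl2Blocks_of_isTotallyReal`), `C` of CM type with condition (D) ⟹ `A × C` satisfies condition (D)
— Moonen–Zarhin Thm. (3.2)(2) for Type I(e₀) of relative dimension one. [cite: MoonenZarhin1999LowDim, §3 Thm. (3.2)(2)]
[cite: Ribet1983, Thm. 0–1] [cite: Hazama1983, §3 (pp. 305–306)] -/
theorem isStablyNondegenerate_prod_of_isTotallyReal_of_isOfCMType (hF : IsField A.endAlgebra)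
    [IsTotallyReal (EndField A hF)] (hdeg : Module.finrank ℚ A.endAlgebra = A.dim) (hC : Milne1999.IsOfCMType C)
    (hCs : IsStablyNondegenerate C) : IsStablyNondegenerate (A.prod C) :=
  (hasRealSl2Blocks_of_isTotallyReal A hF hdeg).isStablyNondegenerate_prod_of_isOfCMType hC hCs

/-- **UNCONDITIONAL: `A × T` is stably nondegenerate, hence all its powers satisfy the Hodge conjecture**, for `End⁰(A)` a
totally real field of degree `dim A` and `T` a simple CM abelian variety of dimension `≤ 3`.
[cite: MoonenZarhin1999LowDim, §3 Thm. (3.2)(2) and §5 (5.2)] [cite: Ribet1983, Thm. 0–1] -/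
theorem isStablyNondegenerate_prod_of_isTotallyReal_of_isSimple_of_isOfCMType_of_dim_le_three (hF : IsField A.endAlgebra)
    [IsTotallyReal (EndField A hF)] (hdeg : Module.finrank ℚ A.endAlgebra = A.dim) {T : AbelianVariety ℂ} (hs : T.IsSimple)
    (h0 : 0 < T.dim) (h3 : T.dim ≤ 3) (hcm : Milne1999.IsOfCMType T) : IsStablyNondegenerate (A.prod T) :=
  (hasRealSl2Blocks_of_isTotallyReal A hF hdeg).isStablyNondegenerate_prod_of_isSimple_of_isOfCMType_of_dim_le_three hs h0 h3 hcm

end RealMultiplication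

end Literature.AlgebraicGeometry.HodgeTheory

end
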